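import Literature.NumberTheory.EllipticCurves.PAdicLFunctionIntegralityAtTwoSplitMultProofs
import Literature.NumberTheory.EllipticCurves.PAdicLFunctionMultiplicativeFunctionalEquationProofs
import HarnessLib

/-!
# `L₂(E, T) ∈ ℤ₂⟦T⟧` at a NON-SPLIT MULTIPLICATIVE `2` — unconditionally (INT2-AUTO-ns)

Topic `NumberTheory/EllipticCurves`; proofs-companion of
`PAdicLFunctionIntegralityAtTwoSplitMultProofs.lean` (INT2-AUTO-sp) for the `2`-adic `L`-function at a
prime of NON-SPLIT multiplicative reduction, i.e. THE power series `L` of the package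
`IsMultPAdicLFunctionOf f 2 (−1) L` (Mazur–Tate–Teitelbaum 1986, §I.10 with `ε(2) = 0`,
`α = a₂ = −1`; it exists, `exists_isMultPAdicLFunctionOf_neg_one_of_nonsplit`, and is unique,
`IsMultPAdicLFunctionOf.unique`). Theorems only; no named fact.

O1 class-closure (X5, `p = 2`, non-CM), typer cc-typer-4 gen 4: this discharges the Néron-integrality
certificate `hint` of the non-split-`2` consumers of `Summits/…/X5/TwoAdicTargetsMultEndAlpha.lean` /
`…MultPub.lean` (α-ns line) to ONE inequality `0 ≤ ord₂ ϖ` on the period ratio, exactly as INT2-AUTO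
(good ordinary) and INT2-AUTO-sp (split) do. The o1 refuter (REFUTER-O1 v7 §30) priced INT2-AUTO-ns as
"NOT hypothesis-free: needs `v₂(L(E,1)/Ω_W) ≥ −2`"; in the `Ω⁺_f`-normalisation the bound is in fact
AUTOMATIC — `6·[0]⁺_f ∈ ℤ` at a non-split multiplicative `2` (`exists_ratPlusSymbol_zero_eq_div_six`
below) — so only the period-ratio inequality survives, as in the split case.

## The argument (all inputs are tree theorems)

For the newform `f ∈ S₂(Γ₀(N))` of a curve non-split multiplicative at `2`: `a₂(f) = −1`, `2 ∣ N`
(`IsNewformOf.cuspCoeff_eq_neg_one_and_dvd_of_nonsplit`), `4 ∤ N` (`a₂ ≠ 0`, Atkin–Lehner Thm. 3,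
`IsNewformOf.not_sq_dvd_level_of_lFunction_ne_zero`), rational real symbols. Then:
* `[1/2]⁺_f = −2[0]⁺_f` — the `U₂`-relation `∑_{b mod 2} [b/2]⁺ = a₂·[0]⁺ = −[0]⁺`
  (`sum_fiber_ratPlusSymbol_eq_neg` at level `0`; MTT §I.4 (4.2) with `ε(2) = 0`);
* `[1/4]⁺_f = [0]⁺_f` — the same relation at level `1` over the odd fibre: `[1/4]⁺ + [3/4]⁺ = −[1/2]⁺`,
  with `[3/4]⁺ = [1/4]⁺` (periodicity + evenness);
* `[a/2ᵐ]⁺_f − [1/2]⁺_f ∈ ½ℤ` for `m ≥ 1` (`exists_ratPlusSymbol_sub_half_eq_div_two`: Cremona Lemma 2.2.3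
  + `re Λ_f = ℤ·Ω⁺_f/2`); at `a/2ᵐ = 1/4` this reads `3[0]⁺ ∈ ½ℤ`, i.e. `[0]⁺_f ∈ ⅙ℤ`, `‖[0]⁺_f‖₂ ≤ 2`,
  and then `[a/2ᵐ]⁺ ∈ ½ℤ − 2[0]⁺` has `‖[a/2ᵐ]⁺‖₂ ≤ 2` for every `m ≥ 1`, `a` odd;
* the coefficients of `L` are limits of the Riemann sums `∑_{u=±1} ∑_{s mod 2ⁿ} (−1)ⁿ⁺²[u5ˢ/2ⁿ⁺²]⁺·C(s,k)`
  (`IsMultPAdicLFunctionOf.tendsto_riemannSum_coeff_of_nonsplit`, MTT §I.13), and the `Δ = {±1}`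
  DOUBLING (`ratPlusSymbol_neg_val_div`) makes each Riemann sum `2 ×` a sum of terms of norm `≤ 2`, so
  of norm `≤ 1`; the unit ball is closed.
So `‖[Tᵏ]L‖₂ ≤ 1` for all `k` (`norm_coeff_le_one_of_isMultPAdicLFunctionOf_neg_one_two`), `L = ι L₀`
for an `L₀ ∈ Λ` (`exists_iwasawaToPowerSeries_eq_of_isMultPAdicLFunctionOf_neg_one_two`), and
`ϖ·L ∈ ι(Λ)` for every `ϖ ∈ ℚ` with `0 ≤ ord₂ ϖ` (`…_C_mul_…`). The bound is sharp: `14a1` (non-split at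
`2`) has `[0]⁺_f = L(E,1)/Ω_E = 1/6`, `L(0) = 2[0]⁺ = 1/3`, a `2`-adic unit.

## References

* B. Mazur, J. Tate, J. Teitelbaum, *On `p`-adic analogues of the conjectures of Birch and
  Swinnerton-Dyer*, Invent. Math. 84 (1986), §I.4 (4.2), §I.8, §I.10, §I.12–I.13.
  [MazurTateTeitelbaum1986Invent]
* J. E. Cremona, *Algorithms for modular elliptic curves* (2nd ed., 1997), §2.2 Lemma 2.2.3, §2.8.
  [CremonaAlgorithms1997]
* A. O. L. Atkin, J. Lehner, *Hecke operators on `Γ₀(m)`*, Math. Ann. 185 (1970), Thm. 3.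
  [AtkinLehner1970]
-/

set_option autoImplicit false

noncomputable section

open scoped MatrixGroups ModularForm

open CongruenceSubgroup WeierstrassCurve Filter Topology
  Literature.NumberTheory.EllipticCurves.ModularForms

namespace Literature.NumberTheory.EllipticCurves

section RiemannSum

variable {W : WeierstrassCurve ℚ} {p : ℕ} [Fact p.Prime] {N : ℕ} [NeZero N]
  {f : CuspForm (Gamma0 N) 2}

/-- **Riemann sums for `[Tᵏ] L_p(E, T)` at a NON-SPLIT multiplicative `p ∣ N` (any prime `p`).**
For the newform `f` of a curve `E = W/ℚ` non-split multiplicative at `p` (`a_p(f) = −1`, `p ∣ N`,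
`IsNewformOf.cuspCoeff_eq_neg_one_and_dvd_of_nonsplit`) and ANY `L` with `IsMultPAdicLFunctionOf f p (−1) L`,
the `k`-th coefficient of `L` is the limit of the Riemann sums
`∑ᶠ_{u ∈ μ} ∑_{s mod pⁿ} (−1)ⁿ⁺ᵉ [u·γˢ / pⁿ⁺ᵉ]⁺_f · C(s, k)` of the SIGNED distribution
`μ(a + pⁿℤ_p) = α⁻ⁿ [a/pⁿ]⁺_f = (−1)ⁿ [a/pⁿ]⁺_f` (MTT §I.10 with `ε(p) = 0`, `α = a_p = −1`; distribution
relation `sum_fiber_ratPlusSymbol_eq_neg`): the explicit Mellin transform of `μ` satisfies the defining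
package (boundedness `exists_norm_ratPlusSymbol_le`, constant term `2[0]⁺` by
`sum_units_signed_ratPlusSymbol_eq`, interpolation by `hasSum_limUnder_riemannSum_mul_pow_of_distribution`)
and the package has at most one solution (`IsMultPAdicLFunctionOf.unique`). The non-split twin of
`IsSplitMultPAdicLFunctionOf.tendsto_riemannSum_coeff`. [cite: MazurTateTeitelbaum1986Invent, §I.10 and §I.12–I.13] -/
theorem IsMultPAdicLFunctionOf.tendsto_riemannSum_coeff_of_nonsplit (hf : IsNewformOf W f)
    (hmult : W.HasMultiplicativeReductionAtPrime p)
    (hns : ¬ W.HasSplitMultiplicativeReductionAtPrime p)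
    {L : PowerSeries ℚ_[p]} (hL : IsMultPAdicLFunctionOf f p (-1) L) (k : ℕ) :
    Tendsto (fun n : ℕ ↦
        ∑ᶠ u : rootsOfUnity (torsionOrder p) ℤ_[p], ∑ s : ZMod (p ^ n),
          ((-1 : ℚ_[p]) ^ (n + cyclotomicExponent p) *
            (ratPlusSymbol f
              (((PadicInt.toZModPow (n + cyclotomicExponent p) ((u : ℤ_[p]ˣ) : ℤ_[p]) *
                  (cyclotomicGenerator p : ZMod (p ^ (n + cyclotomicExponent p))) ^ s.val).val : ℚ) /
                (p : ℚ) ^ (n + cyclotomicExponent p)) : ℚ_[p])) *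
            ((s.val.choose k : ℕ) : ℚ_[p]))
      atTop (𝓝 (PowerSeries.coeff k L)) := by
  classical
  -- the signed distribution `μ(a + p^nℤ_p) = (−1)ⁿ [a/p^n]⁺_f` and its Riemann sums
  set μ : (n : ℕ) → ZMod (p ^ n) → ℚ_[p] :=
    fun n a ↦ (-1 : ℚ_[p]) ^ n * (ratPlusSymbol f ((a.val : ℚ) / (p : ℚ) ^ n) : ℚ_[p]) with hμ_def
  set RS : ℕ → ℕ → ℚ_[p] := fun k n ↦
    ∑ᶠ u : rootsOfUnity (torsionOrder p) ℤ_[p], ∑ s : ZMod (p ^ n),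
      μ (n + cyclotomicExponent p)
          (PadicInt.toZModPow (n + cyclotomicExponent p) ((u : ℤ_[p]ˣ) : ℤ_[p]) *
            (cyclotomicGenerator p : ZMod (p ^ (n + cyclotomicExponent p))) ^ s.val) *
        ((s.val.choose k : ℕ) : ℚ_[p]) with hRS_def
  have hRS : ∀ k n : ℕ, RS k n =
      ∑ᶠ u : rootsOfUnity (torsionOrder p) ℤ_[p], ∑ s : ZMod (p ^ n),
        μ (n + cyclotomicExponent p)
            (PadicInt.toZModPow (n + cyclotomicExponent p) ((u : ℤ_[p]ˣ) : ℤ_[p]) *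
              (cyclotomicGenerator p : ZMod (p ^ (n + cyclotomicExponent p))) ^ s.val) *
          ((s.val.choose k : ℕ) : ℚ_[p]) := fun _ _ ↦ rfl
  -- inputs: rationality of `[r]⁺`, `a_p = -1`, `p ∣ N`, distribution relation, boundedness
  have hQ : coeffField f = ⊥ := hf.coeffField_eq_bot
  have hrat : ∀ r : ℚ, (ratPlusSymbol f r : ℝ) = normalizedPlusSymbol f r :=
    ratCast_ratPlusSymbol_holds hf.1 hQ
  obtain ⟨hap, hpN⟩ := hf.cuspCoeff_eq_neg_one_and_dvd_of_nonsplit hmult hns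
  have hfib := sum_fiber_ratPlusSymbol_eq_neg hrat hf.1 hpN hap
  have hdist : ∀ (n : ℕ) (a : ZMod (p ^ n)),
      ∑ b ∈ Finset.univ.filter (fun b : ZMod (p ^ (n + 1)) ↦
        ZMod.castHom (pow_dvd_pow p n.le_succ) (ZMod (p ^ n)) b = a), μ (n + 1) b = μ n a := by
    intro n a
    simp only [hμ_def]
    rw [← Finset.mul_sum, hfib n a]
    ring
  obtain ⟨C, hC0⟩ := exists_norm_ratPlusSymbol_le (p := p) hf.1 hQ
  have hC : ∀ (n : ℕ) (a : ZMod (p ^ n)), ‖μ n a‖ ≤ C := by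
    intro n a
    simp only [hμ_def]
    rw [norm_mul, norm_pow, norm_neg, norm_one, one_pow, one_mul]
    exact hC0 n a
  -- the explicit Mellin transform of `μ`
  set L₀ : PowerSeries ℚ_[p] := PowerSeries.mk fun k ↦ limUnder atTop fun n ↦ RS k n with hL₀_def
  have hcoeff : ∀ k : ℕ, PowerSeries.coeff k L₀ = limUnder atTop fun n ↦ RS k n := fun k ↦ by
    rw [hL₀_def, PowerSeries.coeff_mk]
  have hL₀ : IsMultPAdicLFunctionOf f p (-1) L₀ := by
    refine ⟨memIwasawaRat_of_forall_norm_coeff_le (C := C) fun k ↦ ?_, ?_,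
      fun m hm χ _ heven hord ↦ ?_⟩
    · rw [hcoeff]
      exact norm_limUnder_riemannSum_le_of_distribution hRS hdist hC k
    · rw [← PowerSeries.coeff_zero_eq_constantCoeff_apply, hcoeff,
        (tendsto_const_nhds.congr fun n ↦
          (riemannSum_zero_of_distribution hRS hdist n).symm).limUnder_eq]
      simp only [hμ_def]
      rw [sum_units_signed_ratPlusSymbol_eq hrat hf.1 hpN hap]
      norm_num
    · obtain ⟨m, rfl⟩ := Nat.exists_eq_succ_of_ne_zero hm.ne'
      have h := hasSum_limUnder_riemannSum_mul_pow_of_distribution hRS hdist hC χ heven hord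
      have hrhs : (∑ a : ZMod (p ^ (m + 1)), χ a * algebraMap ℚ_[p] ℂ_[p] (μ (m + 1) a)) =
          algebraMap ℚ_[p] ℂ_[p] ((-1 : ℚ_[p])⁻¹ ^ (m + 1)) * ratTwistedSymbolSum f χ := by
        rw [← sum_mul_algebraMap_ratPlusSymbol_eq, Finset.mul_sum, inv_neg, inv_one]
        refine Finset.sum_congr rfl fun a _ ↦ ?_
        simp only [hμ_def]
        rw [map_mul]
        ring
      rw [hrhs] at h
      simp only [hcoeff]
      exact h
  -- uniqueness: `L = L₀`
  have hLL : L = L₀ := hL.unique hL₀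
  rw [hLL, hcoeff]
  exact tendsto_riemannSum_of_distribution hRS hdist hC k

end RiemannSum

section Symbols

variable {N : ℕ} [NeZero N] (f : CuspForm (Gamma0 N) 2)

/-- **`[1/2]⁺_f = −2·[0]⁺_f` when `2 ∣ N` and `a₂(f) = −1`** (the non-split multiplicative case): the
`U₂`-distribution relation of the signed measure (`sum_fiber_ratPlusSymbol_eq_neg`, MTT §I.4 (4.2) with
`ε(2) = 0`, `α = a₂ = −1`) at level `0` reads `[0/2]⁺ + [1/2]⁺ = −[0]⁺`. (o1 refuter v7 §30:
"`[1/2]⁺ = (a₂ − 1)[0]⁺`".) [cite: MazurTateTeitelbaum1986Invent, §I.4 (4.2) and §I.10 (ε(p) = 0)] -/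
theorem ratPlusSymbol_half_eq_neg_two_mul_of_cuspCoeff_two_eq_neg_one
    (hrat : ∀ r : ℚ, (ratPlusSymbol f r : ℝ) = normalizedPlusSymbol f r)
    (hf : IsNewform0 f) (h2N : 2 ∣ N) (ha₂ : cuspCoeff f 2 = -1) :
    ratPlusSymbol f (1 / 2) = -2 * ratPlusSymbol f 0 := by
  haveI : Subsingleton (ZMod (2 ^ 0)) := by
    show Subsingleton (ZMod 1)
    infer_instance
  have h := sum_fiber_ratPlusSymbol_eq_neg (p := 2) hrat hf h2N ha₂ 0 0
  rw [Finset.filter_true_of_mem (fun b _ => Subsingleton.elim _ _)] at h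
  have hsum : ∑ b : ZMod (2 ^ (0 + 1)),
      (ratPlusSymbol f ((b.val : ℚ) / ((2 : ℕ) : ℚ) ^ (0 + 1)) : ℚ_[2]) =
      (ratPlusSymbol f 0 : ℚ_[2]) + (ratPlusSymbol f (1 / 2) : ℚ_[2]) := by
    have h2 : ∀ g : ZMod (2 ^ (0 + 1)) → ℚ_[2], ∑ b, g b = g 0 + g 1 := fun g ↦
      Fin.sum_univ_two (f := fun b : Fin 2 => g b)
    rw [h2]
    congr 2
    simp
  rw [hsum] at h
  have h0 : (ratPlusSymbol f (((0 : ZMod (2 ^ 0)).val : ℚ) / ((2 : ℕ) : ℚ) ^ 0) : ℚ_[2]) =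
      (ratPlusSymbol f 0 : ℚ_[2]) := by simp
  rw [h0] at h
  have h' : ((ratPlusSymbol f (1 / 2) : ℚ) : ℚ_[2]) = ((-2 * ratPlusSymbol f 0 : ℚ) : ℚ_[2]) := by
    push_cast
    linear_combination h
  exact_mod_cast h'

/-- **`[1/4]⁺_f = [0]⁺_f` when `2 ∣ N` and `a₂(f) = −1`**: the `U₂`-relation at level `1` over the odd
fibre, `[1/4]⁺ + [3/4]⁺ = a₂·[1/2]⁺ = −[1/2]⁺ = 2[0]⁺` (`sum_fiber_ratPlusSymbol_eq_neg`,
`ratPlusSymbol_half_eq_neg_two_mul_of_cuspCoeff_two_eq_neg_one`), and `[3/4]⁺ = [−1/4 + 1]⁺ = [1/4]⁺`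
(periodicity `ratPlusSymbol_add_intCast_eq`, evenness `ratPlusSymbol_neg`).
[cite: MazurTateTeitelbaum1986Invent, §I.4 (4.2), §I.8 and §I.10] -/
theorem ratPlusSymbol_quarter_eq_of_cuspCoeff_two_eq_neg_one
    (hrat : ∀ r : ℚ, (ratPlusSymbol f r : ℝ) = normalizedPlusSymbol f r)
    (hf : IsNewform0 f) (h2N : 2 ∣ N) (ha₂ : cuspCoeff f 2 = -1) :
    ratPlusSymbol f (1 / 4) = ratPlusSymbol f 0 := by
  have hhalf := ratPlusSymbol_half_eq_neg_two_mul_of_cuspCoeff_two_eq_neg_one f hrat hf h2N ha₂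
  have h34 : ratPlusSymbol f (3 / 4) = ratPlusSymbol f (1 / 4) := by
    rw [show (3 / 4 : ℚ) = -(1 / 4) + ((1 : ℤ) : ℚ) by norm_num, ratPlusSymbol_add_intCast_eq,
      ratPlusSymbol_neg]
  have h := sum_fiber_ratPlusSymbol_eq_neg (p := 2) hrat hf h2N ha₂ 1 1
  have hS : (Finset.univ.filter fun b : ZMod (2 ^ (1 + 1)) ↦
      ZMod.castHom (pow_dvd_pow 2 (1 : ℕ).le_succ) (ZMod (2 ^ 1)) b = (1 : ZMod (2 ^ 1))) =
      {1, 3} := by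
    decide
  rw [hS, Finset.sum_pair (by decide)] at h
  have hv1 : (1 : ZMod (2 ^ (1 + 1))).val = 1 := by decide
  have hv3 : (3 : ZMod (2 ^ (1 + 1))).val = 3 := by decide
  have hv1' : (1 : ZMod (2 ^ 1)).val = 1 := by decide
  rw [hv1, hv3, hv1'] at h
  norm_num at h
  rw [h34, hhalf] at h
  have h' : ((ratPlusSymbol f (1 / 4) : ℚ) : ℚ_[2]) = ((ratPlusSymbol f 0 : ℚ) : ℚ_[2]) := by
    push_cast at h
    linear_combination h / 2
  exact_mod_cast h'

/-- **`[0]⁺_f ∈ ⅙ℤ` when `2 ∣ N`, `4 ∤ N` and `a₂(f) = −1`** (rational real-coefficient symbols): the cusp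
`1/4` is `Γ₀(N)`-equivalent to `1/2` (Cremona Lemma 2.2.3), so `[1/4]⁺ − [1/2]⁺ ∈ ½ℤ`
(`exists_ratPlusSymbol_sub_half_eq_div_two`), and `[1/4]⁺ = [0]⁺`, `[1/2]⁺ = −2[0]⁺` give
`3[0]⁺ ∈ ½ℤ`. Sharp: `14a1` has `[0]⁺_f = 1/6`. [cite: CremonaAlgorithms1997, §2.2 Lemma 2.2.3 and §2.8]
[cite: MazurTateTeitelbaum1986Invent, §I.4 (4.2) and §I.8] -/
theorem exists_ratPlusSymbol_zero_eq_div_six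
    (hrat : ∀ r : ℚ, (ratPlusSymbol f r : ℝ) = normalizedPlusSymbol f r)
    (hreal : ∀ n, (cuspCoeff f n).im = 0) (hf : IsNewform0 f) (h2N : 2 ∣ N) (h4 : ¬ 4 ∣ N)
    (ha₂ : cuspCoeff f 2 = -1) : ∃ k : ℤ, ratPlusSymbol f 0 = (k : ℚ) / 6 := by
  have hden : (1 / 4 : ℚ).den = 4 := by
    rw [one_div]
    exact Rat.inv_ofNat_den 4
  have hr : (1 / 4 : ℚ).den ∣ 2 ^ 2 := by rw [hden]; norm_num
  have hr1 : (1 / 4 : ℚ).den ≠ 1 := by rw [hden]; norm_num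
  obtain ⟨k, hk⟩ := exists_ratPlusSymbol_sub_half_eq_div_two f hrat hreal h2N h4 hr hr1
  rw [ratPlusSymbol_quarter_eq_of_cuspCoeff_two_eq_neg_one f hrat hf h2N ha₂,
    ratPlusSymbol_half_eq_neg_two_mul_of_cuspCoeff_two_eq_neg_one f hrat hf h2N ha₂] at hk
  exact ⟨k, by linear_combination hk / 3⟩

end Symbols

section Two

variable {W : WeierstrassCurve ℚ} {N : ℕ} [NeZero N] {f : CuspForm (Gamma0 N) 2}

/-- The `2`-adic roots of unity of order dividing `2` are `±1` (private helper, as in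
`PAdicLFunctionIntegralityAtTwoSplitMultProofs`). [folklore] -/
private theorem coe_rootsOfUnity_two_eq_or'' (ξ : rootsOfUnity 2 ℤ_[2]) :
    ((ξ : ℤ_[2]ˣ) : ℤ_[2]) = 1 ∨ ((ξ : ℤ_[2]ˣ) : ℤ_[2]) = -1 := by
  have h := ξ.2
  rw [mem_rootsOfUnity] at h
  have h' : (((ξ : ℤ_[2]ˣ) : ℤ_[2])) ^ 2 = 1 := by
    rw [← Units.val_pow_eq_pow_val, h, Units.val_one]
  exact sq_eq_one_iff.mp h'

/-- `Σᶠ_{ξ ∈ μ₂(ℤ₂)} g(ξ) = g(1) + g(−1)`: the torsion of `ℤ₂^×` is `{±1}` (private helper, as in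
`PAdicLFunctionIntegralityAtTwoSplitMultProofs`). [folklore] -/
private theorem finsum_rootsOfUnity_two_eq' {M : Type*} [AddCommMonoid M] (g : ℤ_[2] → M) :
    ∑ᶠ ξ : rootsOfUnity 2 ℤ_[2], g ((ξ : ℤ_[2]ˣ) : ℤ_[2]) = g 1 + g (-1) := by
  classical
  have hζmem : (-1 : ℤ_[2]ˣ) ∈ rootsOfUnity 2 ℤ_[2] := by
    rw [mem_rootsOfUnity]; norm_num
  set ζ : rootsOfUnity 2 ℤ_[2] := ⟨-1, hζmem⟩ with hζ
  have hne : (1 : rootsOfUnity 2 ℤ_[2]) ≠ ζ := by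
    intro h
    have h' : (((1 : rootsOfUnity 2 ℤ_[2]) : ℤ_[2]ˣ) : ℤ_[2]) = ((ζ : ℤ_[2]ˣ) : ℤ_[2]) := by
      rw [h]
    rw [hζ] at h'
    simp only [OneMemClass.coe_one, Units.val_one, Units.val_neg] at h'
    have h2 : (2 : ℤ_[2]) = 0 := by linear_combination h'
    exact two_ne_zero h2
  haveI : Fintype (rootsOfUnity 2 ℤ_[2]) := Fintype.ofFinite _
  have huniv : (Finset.univ : Finset (rootsOfUnity 2 ℤ_[2])) = {1, ζ} := by
    ext ξ
    simp only [Finset.mem_univ, Finset.mem_insert, Finset.mem_singleton, true_iff]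
    rcases coe_rootsOfUnity_two_eq_or'' ξ with h | h
    · left
      exact Subtype.ext (Units.ext (by simpa using h))
    · right
      exact Subtype.ext (Units.ext (by rw [hζ]; simpa using h))
  rw [finsum_eq_sum_of_fintype, huniv, Finset.sum_pair hne]
  simp only [OneMemClass.coe_one, Units.val_one, hζ, Units.val_neg]

omit [NeZero N] in
/-- The denominator of `v / 2ʲ` divides `2ʲ` (private arithmetic helper). [folklore] -/
private theorem den_natCast_div_two_pow_dvd' (v j : ℕ) :
    (((v : ℕ) : ℚ) / ((2 : ℕ) : ℚ) ^ j).den ∣ 2 ^ j := by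
  have h := Rat.den_dvd (v : ℤ) ((2 : ℤ) ^ j)
  rw [Rat.divInt_eq_div] at h
  push_cast at h
  exact_mod_cast h

/-- **`4 ∤ N` for the level of the newform of a curve NON-SPLIT multiplicative at `2`**:
`a₂(f) = a₂(E) = −1` (`IsNewformOf.cuspCoeff_eq_neg_one_and_dvd_of_nonsplit`), and `p² ∣ N ⇒ a_p(f) = 0`
(Atkin–Lehner 1970 Thm. 3, `IsNewformOf.not_sq_dvd_level_of_lFunction_ne_zero`). [cite: AtkinLehner1970, Thm. 3] -/
theorem not_four_dvd_level_of_nonsplit (hf : IsNewformOf W f)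
    (hmult : W.HasMultiplicativeReductionAtPrime 2)
    (hns : ¬ W.HasSplitMultiplicativeReductionAtPrime 2) : ¬ 4 ∣ N := by
  have ha₂ : cuspCoeff f 2 = -1 := (hf.cuspCoeff_eq_neg_one_and_dvd_of_nonsplit hmult hns).1
  have hL2 : W.LFunction 2 ≠ 0 := by
    intro h0
    rw [hf.2 2, h0] at ha₂
    norm_num at ha₂
  have h := hf.not_sq_dvd_level_of_lFunction_ne_zero Nat.prime_two hL2
  norm_num at h
  exact h

/-- **`‖[0]⁺_f‖₂ ≤ 2` for the newform of a curve NON-SPLIT multiplicative at `2` — unconditionally**: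
`[0]⁺_f = k/6`, `k ∈ ℤ` (`exists_ratPlusSymbol_zero_eq_div_six`; the symbols of `f` are rational and real,
`ratCast_ratPlusSymbol_holds`). In particular `ord₂(L(f,1)/Ω⁺_f) ≥ −1`.
[cite: MazurTateTeitelbaum1986Invent, §I.4 (4.2) and §I.8] [cite: CremonaAlgorithms1997, §2.2 Lemma 2.2.3] -/
theorem norm_ratPlusSymbol_zero_le_two_of_nonsplit (hf : IsNewformOf W f)
    (hmult : W.HasMultiplicativeReductionAtPrime 2)
    (hns : ¬ W.HasSplitMultiplicativeReductionAtPrime 2) :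
    ‖((ratPlusSymbol f 0 : ℚ) : ℚ_[2])‖ ≤ 2 := by
  have hQ : coeffField f = ⊥ := hf.coeffField_eq_bot
  have hrat : ∀ r : ℚ, (ratPlusSymbol f r : ℝ) = normalizedPlusSymbol f r :=
    ratCast_ratPlusSymbol_holds hf.1 hQ
  have hreal : ∀ n, (cuspCoeff f n).im = 0 := cuspCoeff_im_eq_zero_of_coeffField_eq_bot hQ
  obtain ⟨ha₂, h2N⟩ := hf.cuspCoeff_eq_neg_one_and_dvd_of_nonsplit hmult hns
  have h4 : ¬ 4 ∣ N := not_four_dvd_level_of_nonsplit hf hmult hns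
  obtain ⟨k, hk⟩ := exists_ratPlusSymbol_zero_eq_div_six f hrat hreal hf.1 h2N h4 ha₂
  rw [hk]
  have h2 : ‖(2 : ℚ_[2])‖ = (2 : ℝ)⁻¹ := by
    have h := Padic.norm_p (p := 2)
    simpa using h
  have h3 : ‖(3 : ℚ_[2])‖ = 1 := by
    have hle : ‖((3 : ℤ) : ℚ_[2])‖ ≤ 1 := Padic.norm_int_le_one (p := 2) 3
    have hnot : ¬ ‖((3 : ℤ) : ℚ_[2])‖ < 1 := by
      rw [Padic.norm_intCast_lt_one_iff]; norm_num
    push_cast at hle hnot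
    exact le_antisymm hle (not_lt.mp hnot)
  have h6 : ‖(6 : ℚ_[2])‖ = (2 : ℝ)⁻¹ := by
    rw [show (6 : ℚ_[2]) = 2 * 3 by norm_num, norm_mul, h2, h3, mul_one]
  have hkn : ‖((k : ℚ) : ℚ_[2])‖ ≤ 1 := by
    have h := Padic.norm_int_le_one (p := 2) k
    simpa using h
  push_cast
  rw [norm_div, h6]
  calc ‖(k : ℚ_[2])‖ / (2 : ℝ)⁻¹ = 2 * ‖(k : ℚ_[2])‖ := by ring
    _ ≤ 2 * 1 := by gcongr; simpa using hkn
    _ = 2 := by ring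

/-- **`‖[x/2ʲ]⁺_f‖₂ ≤ 2` for the newform of a curve NON-SPLIT multiplicative at `2`** (`x ∈ ℤ/2ʲ`,
`x ≠ 0`) — unconditionally: `[x/2ʲ]⁺ ∈ [1/2]⁺ + ½ℤ = ½ℤ − 2[0]⁺`
(`exists_ratPlusSymbol_sub_half_eq_div_two`, `ratPlusSymbol_half_eq_neg_two_mul_of_cuspCoeff_two_eq_neg_one`),
`‖k/2‖₂ ≤ 2` and `‖2[0]⁺‖₂ ≤ 1` (`norm_ratPlusSymbol_zero_le_two_of_nonsplit`); ultrametric inequality.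
[cite: MazurTateTeitelbaum1986Invent, §I.8 and §I.10] [cite: CremonaAlgorithms1997, §2.2 Lemma 2.2.3] -/
theorem norm_ratPlusSymbol_val_div_le_two_of_nonsplit (hf : IsNewformOf W f)
    (hmult : W.HasMultiplicativeReductionAtPrime 2)
    (hns : ¬ W.HasSplitMultiplicativeReductionAtPrime 2)
    {j : ℕ} {x : ZMod (2 ^ j)} (hx : x ≠ 0) :
    ‖((ratPlusSymbol f (((x.val : ℕ) : ℚ) / ((2 : ℕ) : ℚ) ^ j) : ℚ) : ℚ_[2])‖ ≤ 2 := by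
  have hQ : coeffField f = ⊥ := hf.coeffField_eq_bot
  have hrat : ∀ r : ℚ, (ratPlusSymbol f r : ℝ) = normalizedPlusSymbol f r :=
    ratCast_ratPlusSymbol_holds hf.1 hQ
  have hreal : ∀ n, (cuspCoeff f n).im = 0 := cuspCoeff_im_eq_zero_of_coeffField_eq_bot hQ
  obtain ⟨ha₂, h2N⟩ := hf.cuspCoeff_eq_neg_one_and_dvd_of_nonsplit hmult hns
  have h4 : ¬ 4 ∣ N := not_four_dvd_level_of_nonsplit hf hmult hns
  have h0 : ‖((ratPlusSymbol f 0 : ℚ) : ℚ_[2])‖ ≤ 2 :=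
    norm_ratPlusSymbol_zero_le_two_of_nonsplit hf hmult hns
  haveI : NeZero (2 ^ j) := ⟨pow_ne_zero _ two_ne_zero⟩
  set r : ℚ := ((x.val : ℕ) : ℚ) / ((2 : ℕ) : ℚ) ^ j with hr_def
  have hr : r.den ∣ 2 ^ j := den_natCast_div_two_pow_dvd' x.val j
  have hr1 : r.den ≠ 1 := by
    intro h1
    have hvlt : x.val < 2 ^ j := ZMod.val_lt x
    have hv0 : x.val ≠ 0 := fun h0 ↦ hx ((ZMod.val_eq_zero x).mp h0)
    have hr0 : 0 < r := by
      rw [hr_def]; push_cast; positivity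
    have hrlt : r < 1 := by
      rw [hr_def, div_lt_one (by positivity)]
      exact_mod_cast hvlt
    have hrint : (r.num : ℚ) = r := by
      conv_rhs => rw [← Rat.num_div_den r]
      rw [h1]; simp
    have h0' : (0 : ℚ) < r.num := by rw [hrint]; exact hr0
    have h1' : (r.num : ℚ) < 1 := by rw [hrint]; exact hrlt
    have h0z : 0 < r.num := by exact_mod_cast h0'
    have h1z : r.num < 1 := by exact_mod_cast h1'
    omega
  obtain ⟨k, hk⟩ := exists_ratPlusSymbol_sub_half_eq_div_two f hrat hreal h2N h4 hr hr1
  rw [ratPlusSymbol_half_eq_neg_two_mul_of_cuspCoeff_two_eq_neg_one f hrat hf.1 h2N ha₂] at hk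
  have hk' : ratPlusSymbol f r = (k : ℚ) / 2 - 2 * ratPlusSymbol f 0 := by linear_combination hk
  rw [hk']
  have h2 : ‖(2 : ℚ_[2])‖ = (2 : ℝ)⁻¹ := by
    have h := Padic.norm_p (p := 2)
    simpa using h
  have hkn : ‖((k : ℚ) : ℚ_[2])‖ ≤ 1 := by
    have h := Padic.norm_int_le_one (p := 2) k
    simpa using h
  have hA : ‖(((k : ℚ) / 2 : ℚ) : ℚ_[2])‖ ≤ 2 := by
    push_cast
    rw [norm_div, h2]
    calc ‖(k : ℚ_[2])‖ / (2 : ℝ)⁻¹ = 2 * ‖(k : ℚ_[2])‖ := by ring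
      _ ≤ 2 * 1 := by gcongr; simpa using hkn
      _ = 2 := by ring
  have hB : ‖((2 * ratPlusSymbol f 0 : ℚ) : ℚ_[2])‖ ≤ 2 := by
    push_cast
    rw [norm_mul, h2]
    calc (2 : ℝ)⁻¹ * ‖((ratPlusSymbol f 0 : ℚ) : ℚ_[2])‖ ≤ (2 : ℝ)⁻¹ * 2 := by gcongr
      _ ≤ 2 := by norm_num
  push_cast at hA hB ⊢
  calc ‖((k : ℚ_[2]) / 2 - 2 * ((ratPlusSymbol f 0 : ℚ) : ℚ_[2]))‖
      = ‖(k : ℚ_[2]) / 2 + -(2 * ((ratPlusSymbol f 0 : ℚ) : ℚ_[2]))‖ := by rw [sub_eq_add_neg]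
    _ ≤ max ‖(k : ℚ_[2]) / 2‖ ‖-(2 * ((ratPlusSymbol f 0 : ℚ) : ℚ_[2]))‖ :=
        Padic.nonarchimedean _ _
    _ = max ‖(k : ℚ_[2]) / 2‖ ‖2 * ((ratPlusSymbol f 0 : ℚ) : ℚ_[2])‖ := by rw [norm_neg]
    _ ≤ 2 := max_le hA hB

/-- **INT2-AUTO-ns: `‖[Tᵏ] L₂(E, T)‖₂ ≤ 1` at a NON-SPLIT multiplicative `2`, unconditionally.** For
`E = W/ℚ` non-split multiplicative at `2`, `f` its newform (any level) and ANY `L` with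
`IsMultPAdicLFunctionOf f 2 (−1) L`: the Riemann sums
`∑_{u = ±1} ∑_{s mod 2ⁿ} (−1)ⁿ⁺²[u·5ˢ/2ⁿ⁺²]⁺·C(s,k)` converge to `[Tᵏ]L`
(`IsMultPAdicLFunctionOf.tendsto_riemannSum_coeff_of_nonsplit`, MTT §I.13); by the `Δ = {±1}` doubling
(`ratPlusSymbol_neg_val_div`) each is `2 ×` a sum of terms of norm `≤ 2`
(`norm_ratPlusSymbol_val_div_le_two_of_nonsplit`; the binomials are integers), so of norm `≤ 1`, and the
unit ball is closed. No hypothesis on `E[2]`, the `2`-adic image, the Manin constant or `L(E,1)`.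
[cite: MazurTateTeitelbaum1986Invent, §I.10 and §I.12–I.13 (p = 2: Δ = {±1}, γ = 5)] -/
theorem norm_coeff_le_one_of_isMultPAdicLFunctionOf_neg_one_two (hf : IsNewformOf W f)
    (hmult : W.HasMultiplicativeReductionAtPrime 2)
    (hns : ¬ W.HasSplitMultiplicativeReductionAtPrime 2)
    {L : PowerSeries ℚ_[2]} (hL : IsMultPAdicLFunctionOf f 2 (-1) L) (k : ℕ) :
    ‖PowerSeries.coeff k L‖ ≤ 1 := by
  classical
  have hlim := hL.tendsto_riemannSum_coeff_of_nonsplit hf hmult hns k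
  refine le_of_tendsto hlim.norm (Eventually.of_forall fun n ↦ ?_)
  set j : ℕ := n + cyclotomicExponent 2 with hj
  have hj0 : j ≠ 0 := by
    rw [hj, cyclotomicExponent_two]; omega
  set G : ℤ_[2] → ℚ_[2] := fun u ↦ ∑ s : ZMod (2 ^ n),
    ((-1 : ℚ_[2]) ^ j * (ratPlusSymbol f
        ((((PadicInt.toZModPow j u) * (cyclotomicGenerator 2 : ZMod (2 ^ j)) ^ s.val).val : ℚ) /
          ((2 : ℕ) : ℚ) ^ j) : ℚ_[2])) * ((s.val.choose k : ℕ) : ℚ_[2]) with hG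
  have hRS : (∑ᶠ u : rootsOfUnity (torsionOrder 2) ℤ_[2], ∑ s : ZMod (2 ^ n),
      ((-1 : ℚ_[2]) ^ (n + cyclotomicExponent 2) * (ratPlusSymbol f
        ((((PadicInt.toZModPow (n + cyclotomicExponent 2) ((u : ℤ_[2]ˣ) : ℤ_[2])) *
            (cyclotomicGenerator 2 : ZMod (2 ^ (n + cyclotomicExponent 2))) ^ s.val).val : ℚ) /
          ((2 : ℕ) : ℚ) ^ (n + cyclotomicExponent 2)) : ℚ_[2])) * ((s.val.choose k : ℕ) : ℚ_[2])) =
      ∑ᶠ u : rootsOfUnity (torsionOrder 2) ℤ_[2], G ((u : ℤ_[2]ˣ) : ℤ_[2]) := rfl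
  have hGneg : G (-1) = G 1 := by
    simp only [hG, map_neg, map_one, neg_one_mul, one_mul]
    refine Finset.sum_congr rfl fun s _ ↦ ?_
    rw [ratPlusSymbol_neg_val_div]
  have hγ : IsUnit (cyclotomicGenerator 2 : ZMod (2 ^ j)) := isUnit_cyclotomicGenerator_cast (p := 2) j
  have hG1 : ‖G 1‖ ≤ 2 := by
    simp only [hG, map_one, one_mul]
    refine IsUltrametricDist.norm_sum_le_of_forall_le_of_nonneg zero_le_two fun s _ ↦ ?_
    have hx : (cyclotomicGenerator 2 : ZMod (2 ^ j)) ^ s.val ≠ 0 := by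
      haveI : Nontrivial (ZMod (2 ^ j)) := by
        haveI : Fact (1 < 2 ^ j) := ⟨Nat.one_lt_two_pow hj0⟩
        infer_instance
      exact (hγ.pow _).ne_zero
    have hc : ‖((s.val.choose k : ℕ) : ℚ_[2])‖ ≤ 1 := by
      have h := Padic.norm_int_le_one (p := 2) ((s.val.choose k : ℕ) : ℤ)
      rwa [Int.cast_natCast] at h
    have hsgn : ‖(-1 : ℚ_[2]) ^ j‖ = 1 := by rw [norm_pow, norm_neg, norm_one, one_pow]
    rw [norm_mul, norm_mul, hsgn, one_mul]
    calc _ ≤ 2 * 1 := mul_le_mul (norm_ratPlusSymbol_val_div_le_two_of_nonsplit hf hmult hns hx)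
          hc (norm_nonneg _) zero_le_two
      _ = 2 := mul_one _
  have h2 : ‖(2 : ℚ_[2])‖ = (2 : ℝ)⁻¹ := by
    have h := Padic.norm_p (p := 2)
    simpa using h
  rw [hRS, torsionOrder_two, finsum_rootsOfUnity_two_eq', hGneg, ← two_mul, norm_mul, h2]
  calc (2 : ℝ)⁻¹ * ‖G 1‖ ≤ (2 : ℝ)⁻¹ * 2 := by gcongr
    _ = 1 := by norm_num

/-- **`L₂(E, T) ∈ Λ = ℤ₂⟦T⟧` at a NON-SPLIT multiplicative `2`, unconditionally (INT2-AUTO-ns).** For ANY `L`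
with `IsMultPAdicLFunctionOf f 2 (−1) L` there is an `L₀ ∈ Λ` (unique, `ι` injective) with `ι L₀ = L`:
all coefficients have norm `≤ 1` (`norm_coeff_le_one_of_isMultPAdicLFunctionOf_neg_one_two`,
`exists_iwasawaToPowerSeries_eq_iff_norm_coeff_le_one`). [cite: MazurTateTeitelbaum1986Invent, §I.12 (L_p(f) ∈ Λ for ordinary p)] -/
theorem exists_iwasawaToPowerSeries_eq_of_isMultPAdicLFunctionOf_neg_one_two (hf : IsNewformOf W f)
    (hmult : W.HasMultiplicativeReductionAtPrime 2)
    (hns : ¬ W.HasSplitMultiplicativeReductionAtPrime 2)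
    {L : PowerSeries ℚ_[2]} (hL : IsMultPAdicLFunctionOf f 2 (-1) L) :
    ∃ L₀ : IwasawaAlgebra 2, iwasawaToPowerSeries 2 L₀ = L :=
  (exists_iwasawaToPowerSeries_eq_iff_norm_coeff_le_one _).mpr fun k ↦
    norm_coeff_le_one_of_isMultPAdicLFunctionOf_neg_one_two hf hmult hns hL k

omit [NeZero N] in
/-- `‖ϖ‖₂ ≤ 1` from `0 ≤ ord₂ ϖ` (private arithmetic helper). [folklore] -/
private theorem norm_ratCast_le_one_of_padicValRat_nonneg {ϖ : ℚ} (h : 0 ≤ padicValRat 2 ϖ) :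
    ‖((ϖ : ℚ) : ℚ_[2])‖ ≤ 1 := by
  by_cases h0 : ϖ = 0
  · subst h0; simp
  have hϖQ : ((ϖ : ℚ) : ℚ_[2]) ≠ 0 := by exact_mod_cast h0
  rw [Padic.norm_eq_zpow_neg_valuation hϖQ, Padic.valuation_ratCast]
  exact zpow_le_one_of_nonpos₀ (by norm_num) (by linarith)

/-- **`ϖ · L₂(E, T) ∈ ι(Λ)` at a NON-SPLIT multiplicative `2` for every `ϖ ∈ ℚ` with `0 ≤ ord₂ ϖ`** — the
shape of the Néron-integrality certificate `hint` of the X5 non-split consumers (`ϖ · Ω_W = Ω⁺_f`):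
`L = ι L₀` (`exists_iwasawaToPowerSeries_eq_of_isMultPAdicLFunctionOf_neg_one_two`) and `ϖ ∈ ℤ₂`, so
`ϖ · L = ι (C ϖ · L₀)`. [cite: MazurTateTeitelbaum1986Invent, §I.12] -/
theorem exists_iwasawaToPowerSeries_eq_C_mul_of_isMultPAdicLFunctionOf_neg_one_two
    (hf : IsNewformOf W f) (hmult : W.HasMultiplicativeReductionAtPrime 2)
    (hns : ¬ W.HasSplitMultiplicativeReductionAtPrime 2) {ϖ : ℚ} (hϖ : 0 ≤ padicValRat 2 ϖ)
    {L : PowerSeries ℚ_[2]} (hL : IsMultPAdicLFunctionOf f 2 (-1) L) :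
    ∃ L₀ : IwasawaAlgebra 2, iwasawaToPowerSeries 2 L₀ = PowerSeries.C ((ϖ : ℚ) : ℚ_[2]) * L := by
  obtain ⟨G, hG⟩ := exists_iwasawaToPowerSeries_eq_of_isMultPAdicLFunctionOf_neg_one_two hf hmult hns hL
  let ϖ₀ : ℤ_[2] := ⟨((ϖ : ℚ) : ℚ_[2]), norm_ratCast_le_one_of_padicValRat_nonneg hϖ⟩
  refine ⟨(PowerSeries.C ϖ₀ : IwasawaAlgebra 2) * G, ?_⟩
  rw [map_mul, hG, iwasawaToPowerSeries, PowerSeries.map_C]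
  rfl

end Two

end Literature.NumberTheory.EllipticCurves

end
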